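import Summits.BirchSwinnertonDyer.BirchSwinnertonDyer.Theorems.ClassRecordThreeEulerHalvesAtThreeCartanUnramifiedOrderIndexDiv
import HarnessLib

/-!
# Kolyvagin's ORDER bound at `p = 3` on the UNRAMIFIED locus, 3/3: image inputs, D7 re-assembled, the Cartan stub closed (T2 port)

bsd-idea-10 g9 (ideator, lens = transfer; `--supports stmt-BirchSwinnertonDyer-19109 --as helper`). The tree's D7
`ShimuraKolyvaginOfImage.padicValNat_card_sha_three_primary_add_le_of_shimuraLabels_of_irr_of_casselsTate_of_divLab`
(`…ShimuraInertSavingDisplayOfLabels`) is keyed to the EICHLER locus: every bad prime off the inert set `S` SPLITS in `K`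
(`hsp`) and `3 ∈ S`. On the CARTAN locus of the non-split Cartan road (crux `EulerHalvesAtThree`, child item 23422; workfile
`Cruxes/EulerHalvesAtThree/Lines/cartan_display.lean`, stub `stub_cartanOrderMachineAtThree`) the primes of the Cartan set are
inert and UNRAMIFIED with `q² ∥ N`, so `hsp` fails — but D7's proof chain consumes `hsp` at exactly ONE leaf (the Kodaira–Néron
exponent bound at the multiplicative places off `S`, via «split ⇒ unramified»). This port re-keys the chain to the unramified clause.
Nothing here is new mathematics: every proof is the tree's, re-keyed; CONDITIONAL on `casselsTate_levelInputs K` exactly as D7.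
No summit statement, no route crux and no item is proved by these files.

FILE MAP of the port (three files, ≤ 400 lines each; this is file 3/3):
* 1/3 `…CartanUnramifiedShiftEnd` — §1 the leaf on the unramified locus (`kodairaSymbolAt_and_ordMinimalDiscriminant_baseChange_eq_of_unramified`,
  `padicValNat_ordMinimalDiscriminant_le_of_unramified`: A233 along an unramified place, Silverman VII.5.4 (a), under
  `hunr : ∀ ℓ ∣ N, ℓ ∉ S → ℓ ∤ d_K` instead of the split clause `hsp`) and §2 the unit-index end (`Ш = 0`, `Nat.card` form) of
  `…KolyImageUnitEndShift` VERBATIM with the binder `hsp` replaced by the leaf's CONCLUSION `hbd` (suffix `_of_discBound`);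
* 2/3 `…CartanUnramifiedOrderIndexDiv` — §3 McCallum's refined ORDER entry (`…KolyImageOrderEntryEndShiftDiv` Part Two) and §4 the
  INDEX form (`…KolyImageIndexFormEndDiv`), both VERBATIM with `hsp ↦ hbd` (suffix `_of_discBound`);
* 3/3 `…CartanOrderMachineUnramified` — §5 the image inputs from `Irr E[3]` under «every prime of `N` unramified in `K`» and D7
  re-assembled (`…of_divLab_of_unramified`, binders `hin`, `hunr`, `3 ∤ d_K`), §6 the closed form `cartanOrderMachineAtThree` =
  the statement of `stub_cartanOrderMachineAtThree` of `Cruxes/EulerHalvesAtThree/Lines/cartan_display.lean` VERBATIM, proved.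
[cite: McCallumLMS1991, §1 Theorem (Kolyvagin), §4 Cor. 4.5, Lemma 5.1, Cor. 5.6] [cite: GrossLMS1991, §2, §9 (PDF p. 227), Prop. 9.3, §10]
[cite: SilvermanAEC2009, Prop. VII.5.4 (a), Thm. VII.6.1] [cite: Jetchev2008, Thm. 1.1, (1), Cor. 1.5]
[cite: MilneADT2006, Ch. I Thm. 4.10(b), Thm. 6.13(a)] [cite: NeukirchANT1999, Ch. III Thm. (2.12) and Cor.]
presearch: «Kolyvagin order bound for CM points on Shimura curves with non-split (unramified) level» → [corpus:
book:burns2007-l-functions-galois-representations p0536–p0538 (Nekovář 2007, Thm. 3.2), p0559 (2.6.3)] [galaxy: panama:260103219445847]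
— finiteness in print for any Shimura curve and CM point; the ORDER-with-index form only in the tree (D7, Eichler locus).
beyond-print theorem: no (re-keying of tree proofs).
-/

noncomputable section

open scoped Classical Pointwise AddSubgroup

set_option linter.dupNamespace false

universe u

namespace Summit.BirchSwinnertonDyer.BirchSwinnertonDyer.Theorems.ShimuraKolyvaginOfImage

section ImageInputs

open Field WeierstrassCurve NumberField IsDedekindDomain
  Literature.NumberTheory.EllipticCurves Literature.NumberTheory.GaloisRepresentations
  Literature.NumberTheory.EllipticCurves.Rank1Residual
  Summit.BirchSwinnertonDyer.BirchSwinnertonDyer.Theorems.ShimuraKolyvaginImageDisjoint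
  Summit.BirchSwinnertonDyer.BirchSwinnertonDyer.Theorems.ShimuraKolyvaginImageInputs

/-! ### §5a The four image inputs at `p = 3` from `Irr E[3]` when every prime of `N` is unramified in `K` -/

/-- **The four image inputs of the Kolyvagin machine at `p = 3`, base level, from `Irr W 3`, «every prime of `N` is unramified
in `K`» and `3 ∤ d_K`** — `kolyvaginImageInputs_three_of_not_dvd_discr` VERBATIM with Gross's disjointness prime `q ∣ d_K`,
`q ∤ 3N` taken from `hunrN` (any prime factor of `d_K ≠ ±1` is off `N`) instead of «`S` unramified, the rest split»: (hz) some
`z ∈ Γ_K` acts as `−1` on `E(K̄)[3]`; (hS) `E(K̄)[3]` simple; (hCe) scalar commutant; (hbot) `E(K)[3] = 0`. The Cartan locus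
(primes of `S ∪ C` inert-unramified, the rest split) is a special case. [cite: GrossLMS1991, §9 (PDF p. 227, before Prop. 9.1)
and Prop. 9.3] [cite: Cha2005, Lemmas 22–23] -/
theorem kolyvaginImageInputs_three_of_unramified (K : Type u) [Field K] [NumberField K] (W : WeierstrassCurve ℚ)
    [W.IsElliptic] [Fact (Nat.Prime 3)] {N : ℕ}
    (hN : W.conductorNorm ℤ = N) (hirr : W.HasIrreducibleModPGaloisRep 3)
    (hK : IsImaginaryQuadratic K)
    (hunrN : ∀ ℓ : ℕ, ℓ.Prime → ℓ ∣ N → ¬ (ℓ : ℤ) ∣ NumberField.discr K)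
    (h3 : ¬ ((3 : ℕ) : ℤ) ∣ NumberField.discr K) :
    (∃ z : absoluteGaloisGroup K,
        ∀ Q : geomTorsion (W.baseChange K) ((3 : ℕ) : ℤ), z • Q = -Q) ∧
      (W.baseChange K).HasIrreducibleModPGaloisRep 3 ∧
      (∀ f : geomTorsion (W.baseChange K) ((3 : ℕ) : ℤ) →+ geomTorsion (W.baseChange K) ((3 : ℕ) : ℤ),
        (∀ (g : absoluteGaloisGroup K) (t : geomTorsion (W.baseChange K) ((3 : ℕ) : ℤ)),
          f (g • t) = g • f t) → ∃ k : ℤ, ∀ t, f t = k • t) ∧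
      AddSubgroup.torsionBy (W.baseChange K).toAffine.Point ((3 : ℕ) : ℤ) = ⊥ := by
  -- a prime `q ∣ d_K`; it is off `N` by `hunrN`, and `q ≠ 3`
  obtain ⟨q, hq, hqd⟩ := exists_prime_dvd_discr K (by rw [hK.1]; exact one_lt_two)
  have hqN : ¬ q ∣ N := fun h ↦ hunrN q hq h hqd
  have hqN' : ¬ q ∣ W.conductorNorm ℤ := by rwa [hN]
  have hq3 : q ≠ 3 := by
    rintro rfl
    exact h3 hqd
  have hq31 : ¬ (q : ℤ) ∣ ((3 : ℕ) : ℤ) := fun h ↦ by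
    have h' : q ∣ 3 := by exact_mod_cast h
    exact hq3 ((Nat.prime_dvd_prime_iff_eq hq Nat.prime_three).mp h')
  refine ⟨?_, ?_, ?_, ?_⟩
  · exact ShimuraKolyvaginImageOverK.exists_smul_eq_neg_three_of_irr_of_finrank_eq_two W K hK.1 hirr
  · exact hasIrreducibleModPGaloisRep_baseChange W K hK.1 hq hqd hqN' hq31 hirr
  · exact fun f hf ↦ exists_eq_zsmul_baseChange_of_irr W K hK.1 hq hqd hqN' (by decide) hq31 hirr f hf
  · exact ShimuraKolyvaginImageOverK.torsionBy_three_eq_bot_of_irr_of_isImaginaryQuadratic W K hK hirr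

end ImageInputs

section Display

open WeierstrassCurve NumberField IsDedekindDomain Field Function Finset Literature.NumberTheory.EllipticCurves
  Literature.NumberTheory.GaloisRepresentations Literature.NumberTheory.GaloisCohomology
  Literature.NumberTheory.EllipticCurves.KolyvaginCocycle Literature.NumberTheory.EllipticCurves.RingClassField
  Literature.NumberTheory.EllipticCurves.ModularForms Literature.NumberTheory.EllipticCurves.Rank1Residual
  Literature.NumberTheory.EllipticCurves.KolyvaginEuler Literature.NumberTheory.EllipticCurves.KolyvaginDescent
  Summit.BirchSwinnertonDyer.Rank1Residual Summit.BirchSwinnertonDyer.Rank1Residual.X11b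

variable {K : Type} [Field K] [NumberField K] {W : WeierstrassCurve ℚ}

/-! ### §5b D7 re-assembled on the unramified locus -/

/-- **(UNRAMIFIED LOCUS) Kolyvagin's ORDER bound at `p = 3` for EVERY irreducible `E[3]`, REFINED BY GLOBAL DIVISIBILITY — D7 with the split clause `hsp` replaced by `hunr` («every bad prime off `S` is unramified in `K`») and `3 ∈ S` by `3 ∤ d_K`:
`ord₃ #Ш(E/K)[3^∞] + 2t ≤ 2·ord₃[E(K):ℤy]`** for the bottom point `y` of a bare CM family on `X_{N⁺,N⁻}` carrying the printed
labels (B2)–(B5), the guarded index clause AND the label-side global divisibility `hDivLab` to depth `t` (D6), from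
`casselsTate_levelInputs K` (Poitou–Tate fed from its tree theorem) — corner3-p2 g5's
`natCard_sha_three_primary_le_of_shimuraLabels_of_irr_of_casselsTate` VERBATIM with the carrier from D6 and the END from D5;
`M₀ = 0` by the parents' END plus `t = 0` read off the divisibility at `m = 1`. CONDITIONAL on `hCT`, the labels and `hDivLab`.
[cite: McCallumLMS1991, §1 Theorem (Kolyvagin), §4 Cor. 4.5, Lemma 5.1, Cor. 5.6] [cite: Jetchev2008, Thm. 1.1, (1), Cor. 1.5]
[cite: GrossLMS1991, §2, §9, §10] [cite: Kim2022HigherGZ, Thm. 4.3, Rem. 7.9] [cite: MilneADT2006, Ch. I Thm. 4.10(b), Thm. 6.13(a)] -/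
theorem padicValNat_card_sha_three_primary_add_le_of_shimuraLabels_of_irr_of_casselsTate_of_divLab_of_unramified
    (hCT : Literature.NumberTheory.EllipticCurves.casselsTate_levelInputs K)
    [W.IsElliptic] [W.IsGloballyMinimal] {N : ℕ} [NeZero N] (hN : W.conductorNorm ℤ = N)
    (hirr : W.HasIrreducibleModPGaloisRep 3) (hK : IsImaginaryQuadratic K) (ι : K →+* ℂ)
    (Dt : ModularParametrizationData W N) {S : Finset ℕ}
    (hin : ∀ ℓ ∈ S, ℓ.Prime ∧ ℓ ∣ N ∧ ¬ ℓ ^ 2 ∣ N ∧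
      ((Ideal.span {(ℓ : ℤ)}).primesOver (𝓞 K)).ncard = 1 ∧ ¬ (ℓ : ℤ) ∣ NumberField.discr K)
    (hunr : ∀ ℓ : ℕ, ℓ.Prime → ℓ ∣ N → ℓ ∉ S → ¬ (ℓ : ℤ) ∣ NumberField.discr K)
    (h3d : ¬ (3 : ℤ) ∣ NumberField.discr K)
    (ys : (m : ℕ) → (W.baseChange (ringClassField K ι m)).toAffine.Point)
    {y : (W.baseChange K).toAffine.Point} {ε : ℤ} (hε : ε = 1 ∨ ε = -1)
    (hguard : ¬ IsOfFinAddOrder y → 0 < (AddSubgroup.zmultiples y).index)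
    (hB2 : ∀ T : Finset (ringClassField K ι 1 ≃ₐ[ℚ] ringClassField K ι 1),
      (∀ g, g ∈ T ↔ g ∈ ringClassGal ι 1) →
      WeierstrassCurve.Affine.Point.map (W' := W)
          (algebraMap K (ringClassField K ι 1)).toRatAlgHom y =
        ∑ g ∈ T, pointGalHom W (ringClassField K ι 1) g (ys 1))
    (hB3 : ∀ (m : ℕ), m ≠ 0 → ∀ τm : ringClassField K ι m ≃ₐ[ℚ] ringClassField K ι m,
      (∀ x : ringClassField K ι m, ((τm x : ringClassField K ι m) : ℂ) = starRingEnd ℂ x) →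
      ∃ σ' ∈ ringClassGal ι m, IsOfFinAddOrder
        (pointGalHom W (ringClassField K ι m) τm (ys m) -
          ε • pointGalHom W (ringClassField K ι m) σ' (ys m)))
    (hB3K : ∀ c : K ≃ₐ[ℚ] K, c ≠ 1 →
      IsOfFinAddOrder (WeierstrassCurve.Affine.Point.map (W' := W) (c : K →ₐ[ℚ] K) y - ε • y))
    (hB4 : ∀ m : ℕ, Squarefree m →
      (∀ q ∈ m.primeFactors, ¬ q ∣ N ∧ (Ideal.span {(q : 𝓞 K)}).IsPrime) →
      ∀ (ℓ : ℕ) (_ : ℓ ∈ m.primeFactors) (hle : ringClassField K ι (m / ℓ) ≤ ringClassField K ι m)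
        (σ : ringClassField K ι m ≃ₐ[ℚ] ringClassField K ι m),
        Subgroup.zpowers σ = ringClassGalOver ι m (m / ℓ) →
        letI : Algebra K ℂ := ι.toAlgebra
        ∑ i ∈ Finset.range (ℓ + 1), pointGalHom W (ringClassField K ι m) (σ ^ i) (ys m) =
          W.frobeniusTrace ℓ • WeierstrassCurve.Affine.Point.map (W' := W)
            ((RingClassField.inclusion ι hle).restrictScalars ℚ) (ys (m / ℓ)))
    (hB5 : ∀ m : ℕ, Squarefree m →
      (∀ q ∈ m.primeFactors, ¬ q ∣ N ∧ (Ideal.span {(q : 𝓞 K)}).IsPrime) →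
      ∀ (ℓ : ℕ) (_ : ℓ ∈ m.primeFactors) [Fact ℓ.Prime] (hΔ : ¬ (ℓ : ℤ) ∣ minimalDiscriminantInt W)
        (φ₀ : absoluteGaloisGroup (ZMod ℓ)), (∀ x : AlgebraicClosure (ZMod ℓ), φ₀ • x = x ^ ℓ) →
      ∀ (hle : ringClassField K ι (m / ℓ) ≤ ringClassField K ι m)
        (emb : ringClassField K ι m →+* AlgebraicClosure K),
        (∀ x : K, emb (algebraMap K (ringClassField K ι m) x) = algebraMap K (AlgebraicClosure K) x) →
      ∀ (j : (W.baseChange (ringClassField K ι m)).toAffine.Point →+ geomPoints (W.baseChange K)),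
        j = WeierstrassCurve.Affine.Point.map (W' := W) emb.toRatAlgHom →
      ∀ γ : ringClassField K ι m ≃ₐ[ℚ] ringClassField K ι m, γ ∈ ringClassGal ι m →
        letI : Algebra K ℂ := ι.toAlgebra
        geomReduction hΔ ((RatClosure.pointsEquiv (K := K) W).symm
            (j (pointGalHom W (ringClassField K ι m) γ (ys m)))) =
          φ₀ • geomReduction hΔ ((RatClosure.pointsEquiv (K := K) W).symm
            (j (pointGalHom W (ringClassField K ι m) γ
              (WeierstrassCurve.Affine.Point.map (W' := W)
                ((RingClassField.inclusion ι hle).restrictScalars ℚ) (ys (m / ℓ)))))))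
    -- LABEL-SIDE GLOBAL DIVISIBILITY to depth `t` (D6's `hDivLab`, `p = 3`)
    (t : ℕ)
    (hDivLab : ∀ (k M k' : ℕ), Squarefree k' →
      (∀ q ∈ k'.primeFactors, IsKolyvaginPrime N W K 3 q ∧ FrobEqFrobInfty W K (3 ^ (M + k)) q) →
      letI : CommGroup (ringClassGal ι k') := { (inferInstance : Group (ringClassGal ι k')) with
        mul_comm := fun a b ↦ (KolyvaginH44.isMulCommutative_ringClassGal' hK ι k').is_comm.comm a b }
      letI : DistribMulAction (ringClassGal ι k') ((W.baseChange (ringClassField K ι k')).toAffine.Point) :=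
        DistribMulAction.compHom _ ((pointGalHom W (ringClassField K ι k')).comp (ringClassGal ι k').subtype)
      ∀ (σ' : ℕ → ringClassGal ι k') (H' : Subgroup (ringClassGal ι k')) [Fintype (ringClassGal ι k' ⧸ H')]
        (f' : ringClassGal ι k' ⧸ H' → ringClassGal ι k'),
        (∀ q ∈ k'.primeFactors, σ' q ^ (q + 1) = 1) →
        (∀ q ∈ k'.primeFactors, Subgroup.zpowers (σ' q : ringClassField K ι k' ≃ₐ[ℚ] ringClassField K ι k') =
          ringClassGalOver ι k' (k' / q)) →
        (∀ c, (f' c : ringClassGal ι k' ⧸ H') = c) →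
        (∀ h ∈ H', (h : ringClassField K ι k' ≃ₐ[ℚ] ringClassField K ι k') ∈ ringClassGalOver ι k' 1) →
        ∃ B : (W.baseChange (ringClassField K ι k')).toAffine.Point,
          ((3 ^ M : ℕ) : ℤ) • B = ((3 : ℤ) ^ (M - t)) • kolyvaginPoint σ' k'.primeFactors f' (ys k'))
    (hnt : ¬ IsOfFinAddOrder y) :
    padicValNat 3 (Nat.card (AddCommGroup.primaryComponent (W.baseChange K).sha 3)) + 2 * t ≤
      2 * padicValNat 3 (AddSubgroup.zmultiples y).index := by
  haveI : Fact (Nat.Prime 3) := ⟨Nat.prime_three⟩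
  haveI hEK : (W.baseChange K).IsElliptic := inferInstanceAs (W.map (algebraMap ℚ K)).IsElliptic
  -- Poitou–Tate over `K` is a tree THEOREM (`PoitouTateNumberField.lean`)
  have hPT : poitouTate_sum_localTatePairing_eq_zero K := poitouTate_sum_localTatePairing_eq_zero_holds K
  have hp : (3 : ℕ).Prime := Nat.prime_three
  have hp2 : (3 : ℕ) ≠ 2 := by decide
  have h3d' : ¬ ((3 : ℕ) : ℤ) ∣ NumberField.discr K := by exact_mod_cast h3d
  -- every prime of `N` is unramified in `K`: the inert clause on `S`, `hunr` off `S`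
  have hunrN : ∀ ℓ : ℕ, ℓ.Prime → ℓ ∣ N → ¬ (ℓ : ℤ) ∣ NumberField.discr K := fun ℓ hℓ hℓN ↦ by
    by_cases hℓS : ℓ ∈ S
    · exact (hin ℓ hℓS).2.2.2.2
    · exact hunr ℓ hℓ hℓN hℓS
  -- the Kodaira–Néron exponent bound at the multiplicative places off `S` (§1, A233 along an unramified place)
  have hbd : ∀ w : IsDedekindDomain.HeightOneSpectrum (𝓞 K), (W.baseChange K).HasMultiplicativeReductionAt w →
      ((Rat.HeightOneSpectrum.primesEquiv (w.under (𝓞 ℚ)) : ℕ)) ∉ S →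
      padicValNat 3 ((W.baseChange K).ordMinimalDiscriminant w) ≤
        1 + ∑ q ∈ N.primeFactors, padicValNat 3 (padicValInt q W.minimalDiscriminantInt) := fun w hmw hℓS ↦
    padicValNat_ordMinimalDiscriminant_le_of_unramified hK W hN 3 hunr w hmw hℓS
  -- (i) the four image inputs at `3` from `Irr` alone
  obtain ⟨hIz, hIs, hIc, hIt⟩ := kolyvaginImageInputs_three_of_unramified K W hN hirr hK hunrN h3d'
  -- (ii) no `3`-power torsion over the ring class fields of conductor prime to `3` (x11b3, from `Irr`)
  have hKunr : ∀ v : HeightOneSpectrum (𝓞 ℚ), ((3 : ℕ) : 𝓞 ℚ) ∈ v.asIdeal →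
      Algebra.IsUnramifiedIn (𝓞 K) v.asIdeal := isUnramifiedIn_rat_of_not_dvd_discr K hp h3d'
  have htor : ∀ k' : ℕ, k' ≠ 0 → ¬ 3 ∣ k' →
      ∀ (n' : ℕ) (a : (W.baseChange (ringClassField K ι k')).toAffine.Point),
        ((3 ^ n' : ℕ) : ℤ) • a = 0 → a = 0 := by
    intro k' hk' h3k' n' a ha
    have hbot := NoTorsionIrr.torsionBy_pow_ringClassField_eq_bot_of_hasIrreducibleModPGaloisRep W hK ι hk' hp hp2
      hirr (W.exists_weilPairing_holds 3) hKunr h3k' n'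
    have hmem : a ∈ AddSubgroup.torsionBy (W.baseChange (ringClassField K ι k')).toAffine.Point ((3 ^ n' : ℕ) : ℤ) :=
      (Submodule.mem_torsionBy_iff _ _).mpr ha
    rwa [hbot, AddSubgroup.mem_bot] at hmem
  -- the depth-`k` ring-class-rational Div-carrier on `y` from the labels (D6)
  have hpointsRk := hpointsRkDiv_of_shimuraLabels_of_noTorsion_of_divLab hK ι hN Dt hp hp2 htor ys hε hB2 hB3 hB3K hB4
    hB5 t hDivLab
  have hidx : 0 < (AddSubgroup.zmultiples y).index := hguard hnt
  -- the level `M₀ = ord₃ [E(K):ℤy]`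
  set M₀ : ℕ := padicValNat 3 (AddSubgroup.zmultiples y).index with hM₀def
  have hv : padicValNat 3 (AddSubgroup.zmultiples y).index = M₀ := rfl
  rcases Nat.eq_zero_or_pos M₀ with h0M | hpos
  · -- unit index: `Ш(E/K)[3^∞] = 0` by the parents' `M₀ = 0` END (divisibility conjunct dropped), and `t = 0` from the
    -- divisibility at `m = 1`, level `3` (`δ₃ y = 0 ⟹ y ∈ 3E(K)`, contradicting `3 ∤ [E(K):ℤy]`)
    rw [h0M] at hv
    have hcard := natCard_primaryComponent_sha_le_of_ringClassRationalPointsM_shift_of_poitouTate_ofImage_of_discBound hPT W hN hp2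
      hIz hIs hIc hIt hK ι hin hbd hnt hidx hv (fun k M hM hdiv c hc ↦ by
        obtain ⟨ε', τ, hτ, A, hA, emb, Pt, hPt, hε', h53, hAτ, hPt1, hrat, hAk, hm'⟩ := hpointsRk k hM hdiv c hc
        exact ⟨ε', τ, hτ, A, hA, emb, Pt, hPt, hε', h53, hAτ, hPt1, hrat, hAk, fun m hm hk ↦
          ⟨(hm' m hm hk).1, (hm' m hm hk).2.1, (hm' m hm hk).2.2.1⟩⟩)
    rw [hv, mul_zero, pow_zero] at hcard
    have hv0 : padicValNat 3 (Nat.card (AddCommGroup.primaryComponent (W.baseChange K).sha 3)) = 0 := by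
      rw [padicValNat.eq_zero_iff]
      rcases Nat.le_one_iff_eq_zero_or_eq_one.mp hcard with h | h
      · exact Or.inr (Or.inl h)
      · exact Or.inr (Or.inr (by rw [h]; decide))
    have hAp : ∀ a : (W.baseChange K).toAffine.Point, ((3 : ℕ) : ℤ) • a = 0 → a = 0 := fun a ha ↦ by
      have : a ∈ AddSubgroup.torsionBy (W.baseChange K).toAffine.Point ((3 : ℕ) : ℤ) := by
        rw [mem_torsionBy_iff]; exact ha
      rw [hIt] at this
      exact this
    obtain ⟨-, hmax'⟩ :=
      Summit.BirchSwinnertonDyer.Rank1Residual.Additive.zsmul_certificate_of_padicValNat_index hp hAp hnt hidx.ne' hv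
    obtain ⟨c, hc1, -⟩ := exists_conj_of_isImaginaryQuadratic (K := K) hK
    have ht : t = 0 := by
      by_contra ht0
      have hdiv1 : ∀ Q : geomPoints (W.baseChange K), ∃ R, ((3 ^ 1 : ℕ) : ℤ) • R = Q := fun Q ↦
        (W.baseChange K).zsmul_geomPoints_surjective_holds (by exact_mod_cast pow_ne_zero 1 hp.ne_zero) Q
      obtain ⟨ε', τ, hτ, A, hA, emb, Pt, hPt, -, -, -, hPt1, -, -, hm'⟩ := hpointsRk 0 le_rfl hdiv1 c hc1
      have h1 := (hm' 1 squarefree_one (by simp)).2.2.2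
      rw [show 1 - t = 0 by omega, pow_zero, one_smul] at h1
      have hP1 : toGeomPoints (W.baseChange K) y ∈
          KolyvaginCocycle.invPoints (Field.absoluteGaloisGroup K) (A 1) ((3 ^ 1 : ℕ) : ℤ) := by
        rw [← hPt1]; exact hPt 1
      rw [kolyvaginClass_congr_point (hA 1) (hP' := hP1) hPt1, kolyvaginClass_toGeomPoints (hA 1) y hP1] at h1
      have hker : y ∈ (kummerMapTorsion (W.baseChange K) _ hdiv1).ker := by
        rw [AddMonoidHom.mem_ker, h1]
      rw [kummerMapTorsion_ker, AddMonoidHom.mem_range] at hker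
      obtain ⟨z, hz⟩ := hker
      exact hmax' ⟨z, hz⟩
    omega
  -- divisible index: the REFINED ORDER form at level `3^{M₀}`, `M₀ ≥ 1` (D5)
  haveI : NeZero (3 ^ M₀) := ⟨pow_ne_zero _ hp.ne_zero⟩
  obtain ⟨c, hc1, hcc⟩ := exists_conj_of_isImaginaryQuadratic (K := K) hK
  have h2 : 2 ≤ 3 ^ M₀ * 3 ^ M₀ :=
    le_trans (le_trans hp.two_le (Nat.le_self_pow hpos.ne' 3)) (Nat.le_mul_of_pos_right _ (NeZero.pos (3 ^ M₀)))
  have hq : ((3 ^ M₀ * 3 ^ M₀ : ℕ) : K) ≠ 0 := Nat.cast_ne_zero.mpr (NeZero.ne (3 ^ M₀ * 3 ^ M₀))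
  obtain ⟨e, hμ, hadd₁, hadd₂, halt, hnd, hgal⟩ := exists_weilPairing_holds (W.baseChange K) (3 ^ M₀ * 3 ^ M₀) h2 hq
  obtain ⟨inv, hPT', hH3, hperf, hB, hPτ⟩ := hCT W 3 M₀ hp hp2 hpos c hc1 hcc e hμ hadd₁ hadd₂ hgal halt hnd
  exact padicValNat_card_sha_primary_add_le_of_ringClassRationalPointsMDiv_shift_of_poitouTate_of_localDuality_ofImage_of_discBound
    hPT W hN hp2 hIz hIs hIc hIt hK ι hin hbd hnt hidx hv hc1 hcc t hpointsRk e hμ hadd₁ hadd₂ hgal halt hnd inv hPT'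
    (fun v ↦ (hperf v).1.injective) hH3 hB hPτ

/-! ### §6 The closed form consumed by `Cruxes/EulerHalvesAtThree/Lines/cartan_display.lean` -/

/-- **`stub_cartanOrderMachineAtThree` of the Cartan display workfile, VERBATIM, PROVED** (closed `∀` form of §5b).
[cite: McCallumLMS1991, §1 Theorem (Kolyvagin), Cor. 5.6] [cite: GrossLMS1991, §9 Prop. 9.3, §10] -/
theorem cartanOrderMachineAtThree :
    ∀ {K : Type} [Field K] [NumberField K] {W : WeierstrassCurve ℚ},
      Literature.NumberTheory.EllipticCurves.casselsTate_levelInputs K →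
    ∀ [W.IsElliptic] [W.IsGloballyMinimal] {N : ℕ} [NeZero N], W.conductorNorm ℤ = N →
      W.HasIrreducibleModPGaloisRep 3 → ∀ (hK : IsImaginaryQuadratic K) (ι : K →+* ℂ)
      (Dt : ModularParametrizationData W N) {S : Finset ℕ},
      (∀ ℓ ∈ S, ℓ.Prime ∧ ℓ ∣ N ∧ ¬ ℓ ^ 2 ∣ N ∧
        ((Ideal.span {(ℓ : ℤ)}).primesOver (𝓞 K)).ncard = 1 ∧ ¬ (ℓ : ℤ) ∣ NumberField.discr K) →
      (∀ ℓ : ℕ, ℓ.Prime → ℓ ∣ N → ℓ ∉ S → ¬ (ℓ : ℤ) ∣ NumberField.discr K) →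
      ¬ (3 : ℤ) ∣ NumberField.discr K →
    ∀ (ys : (m : ℕ) → (W.baseChange (ringClassField K ι m)).toAffine.Point)
      {y : (W.baseChange K).toAffine.Point} {ε : ℤ}, (ε = 1 ∨ ε = -1) →
      (¬ IsOfFinAddOrder y → 0 < (AddSubgroup.zmultiples y).index) →
      (∀ T : Finset (ringClassField K ι 1 ≃ₐ[ℚ] ringClassField K ι 1),
        (∀ g, g ∈ T ↔ g ∈ ringClassGal ι 1) →
        WeierstrassCurve.Affine.Point.map (W' := W)
            (algebraMap K (ringClassField K ι 1)).toRatAlgHom y =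
          ∑ g ∈ T, pointGalHom W (ringClassField K ι 1) g (ys 1)) →
      (∀ (m : ℕ), m ≠ 0 → ∀ τm : ringClassField K ι m ≃ₐ[ℚ] ringClassField K ι m,
        (∀ x : ringClassField K ι m, ((τm x : ringClassField K ι m) : ℂ) = starRingEnd ℂ x) →
        ∃ σ' ∈ ringClassGal ι m, IsOfFinAddOrder
          (pointGalHom W (ringClassField K ι m) τm (ys m) -
            ε • pointGalHom W (ringClassField K ι m) σ' (ys m))) →
      (∀ c : K ≃ₐ[ℚ] K, c ≠ 1 →
        IsOfFinAddOrder (WeierstrassCurve.Affine.Point.map (W' := W) (c : K →ₐ[ℚ] K) y - ε • y)) →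
      (∀ m : ℕ, Squarefree m →
        (∀ q ∈ m.primeFactors, ¬ q ∣ N ∧ (Ideal.span {(q : 𝓞 K)}).IsPrime) →
        ∀ (ℓ : ℕ) (_ : ℓ ∈ m.primeFactors) (hle : ringClassField K ι (m / ℓ) ≤ ringClassField K ι m)
          (σ : ringClassField K ι m ≃ₐ[ℚ] ringClassField K ι m),
          Subgroup.zpowers σ = ringClassGalOver ι m (m / ℓ) →
          letI : Algebra K ℂ := ι.toAlgebra
          ∑ i ∈ Finset.range (ℓ + 1), pointGalHom W (ringClassField K ι m) (σ ^ i) (ys m) =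
            W.frobeniusTrace ℓ • WeierstrassCurve.Affine.Point.map (W' := W)
              ((RingClassField.inclusion ι hle).restrictScalars ℚ) (ys (m / ℓ))) →
      (∀ m : ℕ, Squarefree m →
        (∀ q ∈ m.primeFactors, ¬ q ∣ N ∧ (Ideal.span {(q : 𝓞 K)}).IsPrime) →
        ∀ (ℓ : ℕ) (_ : ℓ ∈ m.primeFactors) [Fact ℓ.Prime] (hΔ : ¬ (ℓ : ℤ) ∣ minimalDiscriminantInt W)
          (φ₀ : absoluteGaloisGroup (ZMod ℓ)), (∀ x : AlgebraicClosure (ZMod ℓ), φ₀ • x = x ^ ℓ) →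
        ∀ (hle : ringClassField K ι (m / ℓ) ≤ ringClassField K ι m)
          (emb : ringClassField K ι m →+* AlgebraicClosure K),
          (∀ x : K, emb (algebraMap K (ringClassField K ι m) x) = algebraMap K (AlgebraicClosure K) x) →
        ∀ (j : (W.baseChange (ringClassField K ι m)).toAffine.Point →+ geomPoints (W.baseChange K)),
          j = WeierstrassCurve.Affine.Point.map (W' := W) emb.toRatAlgHom →
        ∀ γ : ringClassField K ι m ≃ₐ[ℚ] ringClassField K ι m, γ ∈ ringClassGal ι m →
          letI : Algebra K ℂ := ι.toAlgebra
          geomReduction hΔ ((RatClosure.pointsEquiv (K := K) W).symm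
              (j (pointGalHom W (ringClassField K ι m) γ (ys m)))) =
            φ₀ • geomReduction hΔ ((RatClosure.pointsEquiv (K := K) W).symm
              (j (pointGalHom W (ringClassField K ι m) γ
                (WeierstrassCurve.Affine.Point.map (W' := W)
                  ((RingClassField.inclusion ι hle).restrictScalars ℚ) (ys (m / ℓ))))))) →
    -- LABEL-SIDE GLOBAL DIVISIBILITY to depth `t` (D6's `hDivLab`, `p = 3`)
    ∀ (t : ℕ),
      (∀ (k M k' : ℕ), Squarefree k' →
        (∀ q ∈ k'.primeFactors, IsKolyvaginPrime N W K 3 q ∧ FrobEqFrobInfty W K (3 ^ (M + k)) q) →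
        letI : CommGroup (ringClassGal ι k') := { (inferInstance : Group (ringClassGal ι k')) with
          mul_comm := fun a b ↦ (KolyvaginH44.isMulCommutative_ringClassGal' hK ι k').is_comm.comm a b }
        letI : DistribMulAction (ringClassGal ι k') ((W.baseChange (ringClassField K ι k')).toAffine.Point) :=
          DistribMulAction.compHom _ ((pointGalHom W (ringClassField K ι k')).comp (ringClassGal ι k').subtype)
        ∀ (σ' : ℕ → ringClassGal ι k') (H' : Subgroup (ringClassGal ι k')) [Fintype (ringClassGal ι k' ⧸ H')]
          (f' : ringClassGal ι k' ⧸ H' → ringClassGal ι k'),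
          (∀ q ∈ k'.primeFactors, σ' q ^ (q + 1) = 1) →
          (∀ q ∈ k'.primeFactors, Subgroup.zpowers (σ' q : ringClassField K ι k' ≃ₐ[ℚ] ringClassField K ι k') =
            ringClassGalOver ι k' (k' / q)) →
          (∀ c, (f' c : ringClassGal ι k' ⧸ H') = c) →
          (∀ h ∈ H', (h : ringClassField K ι k' ≃ₐ[ℚ] ringClassField K ι k') ∈ ringClassGalOver ι k' 1) →
          ∃ B : (W.baseChange (ringClassField K ι k')).toAffine.Point,
            ((3 ^ M : ℕ) : ℤ) • B = ((3 : ℤ) ^ (M - t)) • kolyvaginPoint σ' k'.primeFactors f' (ys k')) →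
      ¬ IsOfFinAddOrder y →
      padicValNat 3 (Nat.card (AddCommGroup.primaryComponent (W.baseChange K).sha 3)) + 2 * t ≤
        2 * padicValNat 3 (AddSubgroup.zmultiples y).index := by
  intro K _ _ W hCT _ _ N _ hN hirr hK ι Dt S hin hunr h3d ys y ε hε hguard hB2 hB3 hB3K hB4 hB5 t hDivLab hnt
  exact padicValNat_card_sha_three_primary_add_le_of_shimuraLabels_of_irr_of_casselsTate_of_divLab_of_unramified hCT hN
    hirr hK ι Dt hin hunr h3d ys hε hguard hB2 hB3 hB3K hB4 hB5 t hDivLab hnt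

end Display

end Summit.BirchSwinnertonDyer.BirchSwinnertonDyer.Theorems.ShimuraKolyvaginOfImage

end
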